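import Literature.NumberTheory.Rogawski1990.ArchExplicitTransferFactorCayleyTorus     -- ★ LH3-p04 (g2) p849548 (Δ-def-explicit)+(κ-TABLE): `archExplicitDelta_cayleyTorus_relabel_eq_mul`
import Literature.NumberTheory.Rogawski1990.ArchCanonicalTransferFactor                -- ★ `archMajoritySign_mul_self`
import HarnessLib

/-!
# (Δ-mirror), compact chart: `Δ″(γ_H(z), t(z∘ρ°)) = ± Δ″(γ_H(z), t(z∘ρ))` EXACTLY, for the mirror partner `ρ°` across each wall, with the sign read off the κ-table
# (Rogawski 1990 §4.9 p. 55, §14.6 p. 242; Langlands–Shelstad 1987 §2.4; Shelstad 1979 §4)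

Topic `NumberTheory/Rogawski1990`; namespace `Literature.NumberTheory.Rogawski1990`.  THEOREMS ONLY (no `def`, no instance, no notation, no axiom, no named fact, no `sorry`).
Cell `pub/hodgecm-mathlib`, line LH3 (closer stub `stub_N9`, crux H413 = `stmt-HodgeConjecture-24833`), DIRECT ROAD organ **(Δ-mirror)** of LH3-plan (g2)'s D2′-SPEC §3b («(Δ-mirror)
EXACTNESS is load-bearing; census item #1 for p04»): on the compact chart (the Cayley-frame family `γ_H(z)`, equality binder `hγH`, partners `t(z∘ρ)` = the diagonal torus point whose
slot `i` at `w` carries `z_{w, ρ_w i}`) the explicit factor of ★ p849548 is `Δ″(γ_H(z), t(z∘ρ)) = K_ρ · (τ·D_{G∕H})(γ_H(z))` with `(τ·D)` INDEPENDENT OF THE PARTNER and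
`K_ρ = Π_w sgn(re σ_w α_{ρ_w⁻¹(1)})·η_w ∈ {±1}` (`α_i ≠ 0` hermitian).  Hence for ANY two partners `Δ″_{ρ′} = (K_{ρ′}K_ρ)·Δ″_ρ` as an identity of functions of `z` (ALL `z`, not only near
a wall), and for the MIRROR partner `ρ° = update ρ w ((i j)·ρ_w)` across the wall `z_i = z_j` at `w` the sign `K_{ρ°}K_ρ` is: `−1` across a `G`-wall `z₁ = z₀` or `z₁ = z₂` whose
two slots `ρ_w⁻¹(1), ρ_w⁻¹(0)` (resp. `ρ_w⁻¹(1), ρ_w⁻¹(2)`) have OPPOSITE form signs (noncompact wall), `+1` when they have the same sign (compact wall), and ALWAYS `+1` across the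
`H`-wall `z₀ = z₂` (the 1-block slot `ρ_w⁻¹(1)` does not move) — the κ-TABLE of D2′-SPEC §3 («opposite κ across G-walls, equal κ across the H-wall»), now as exact identities.

WHAT IS PROVED (`K_ρ` spelled out as the product above).
* `kappaSignProd_mul_self` — `K_ρ · K_ρ = 1`;  `archExplicitDelta_cayleyTorus_relabel_eq_sign_mul_relabel` — `Δ″(γ_H(z), t(z∘ρ′)) = (K_{ρ′}K_ρ) · Δ″(γ_H(z), t(z∘ρ))` for all `z, ρ, ρ′`;
* `kappaSignProd_update_swap_mul` — `K_{update ρ w (π·ρ_w)} · K_ρ = sgn(re σ_w α_{ρ_w⁻¹(π⁻¹ 1)}) · sgn(re σ_w α_{ρ_w⁻¹ 1})` (only the `w`-factor moves);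
* the three walls: `archExplicitDelta_cayleyTorus_mirror01_of_neg ∕ _of_pos` (`z₁ = z₀`), `…mirror12_of_neg ∕ _of_pos` (`z₁ = z₂`), `…mirror02` (`z₀ = z₂`, always `+`).
HONEST LABEL: HC_CM is proved only modulo the 7 printed citations (2 remaining: hLiu418 = stmt-HodgeConjecture-24832, h413 = stmt-HodgeConjecture-24833) until rung 0 closes; this organ feeds
(M2-indef)∕(M3) of `stub_N9`'s L2 and pays nothing by itself.

## References
* [Rogawski1990] J. D. Rogawski, *Automorphic Representations of Unitary Groups in Three Variables*, Ann. of Math. Stud. 123 (1990), §4.9 p. 55, §14.6 p. 242, §8.2 pp. 122–124.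
* [LanglandsShelstad1987] R. P. Langlands, D. Shelstad, *On the definition of transfer factors*, Math. Ann. 278 (1987), §2.4.
* [Shelstad1979] D. Shelstad, *Characters and inner forms of a quasi-split group over ℝ*, Compositio Math. 39 (1979), §4.
-/

set_option autoImplicit false

noncomputable section

open NumberField NumberField.InfinitePlace Equiv
open scoped MatrixGroups ComplexConjugate
open Literature.NumberTheory.Automorphic Literature.NumberTheory.GaloisRepresentations

namespace Literature.NumberTheory.Rogawski1990

section Mirror

variable (L : Type) [Field L] [NumberField L] [IsCMField L] (α : Fin 3 → L)
  (γH : ({w : InfinitePlace L // IsComplex w} → Fin 3 → Circle) →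
    ↥(UnitaryGroup.arch (↥(maximalRealSubfield L)) L (IsCMField.complexConj L) 2
        (Matrix.of fun i j : Fin 2 => if i.val + j.val + 1 = 2 then (1 : L) else 0)) ×
      ↥(UnitaryGroup.arch (↥(maximalRealSubfield L)) L (IsCMField.complexConj L) 1
        (Matrix.of fun i j : Fin 1 => if i.val + j.val + 1 = 1 then (1 : L) else 0)))
  (hγH : γH = fun z =>
    ((UnitaryGroup.archPiEquivCM 2 L (Matrix.of fun i j : Fin 2 => if i.val + j.val + 1 = 2 then (1 : L) else 0)).symm fun w =>
        ⟨Matrix.GeneralLinearGroup.mkOfDetNeZero !![(1 : ℂ), 1; 1, -1] UnitaryGroup.det_cayleyTwo_ne_zero *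
            UnitaryGroup.circleDiagonal 2 ![z w 0, z w 2] *
          (Matrix.GeneralLinearGroup.mkOfDetNeZero !![(1 : ℂ), 1; 1, -1] UnitaryGroup.det_cayleyTwo_ne_zero)⁻¹,
          UnitaryGroup.cayley_conj_circleDiagonal_mem_archLocal L w _⟩,
      (UnitaryGroup.archPiEquivCM 1 L (Matrix.of fun i j : Fin 1 => if i.val + j.val + 1 = 1 then (1 : L) else 0)).symm fun w =>
        ⟨UnitaryGroup.circleDiagonal 1 ![z w 1], UnitaryGroup.circleDiagonal_mem_archLocal_antidiagOne L w _⟩))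
  (μ : HeckeCharacter L)

/-- `sgn(x)·sgn(x) = 1` for `x ≠ 0` (in `ℤ`). [folklore] -/
private theorem sign_intCast_mul_self {x : ℝ} (hx : x ≠ 0) : (SignType.sign x : ℤ) * (SignType.sign x : ℤ) = 1 := by
  rcases lt_or_gt_of_ne hx with h | h
  · rw [sign_neg h]; simp
  · rw [sign_pos h]; simp

open scoped Classical in
/-- **`K_ρ · K_ρ = 1`**: every factor `sgn(re σ_w α_{ρ_w⁻¹(1)})·η_w` of the κ-sign product is `±1` (`α_i ≠ 0` hermitian ⇒ `re σ_w α_i ≠ 0`; ★ `archMajoritySign_mul_self`).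
[cite: Rogawski1990, §14.6 p. 242] -/
theorem kappaSignProd_mul_self (hα : ∀ i, α i ≠ 0) (hherm : ∀ i, (IsCMField.complexConj L (α i) : L) = α i)
    (ρ : {w : InfinitePlace L // IsComplex w} → Perm (Fin 3)) :
    (∏ w : {w : InfinitePlace L // IsComplex w}, ((SignType.sign ((w.1.embedding (α ((ρ w).symm 1))).re) : ℤ) * archMajoritySign L (Matrix.diagonal α) w)) *
      (∏ w : {w : InfinitePlace L // IsComplex w}, ((SignType.sign ((w.1.embedding (α ((ρ w).symm 1))).re) : ℤ) * archMajoritySign L (Matrix.diagonal α) w)) = 1 := by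
  rw [← Finset.prod_mul_distrib]
  refine Finset.prod_eq_one fun w _ => ?_
  have hre : (w.1.embedding (α ((ρ w).symm 1))).re ≠ 0 := fun h =>
    hα _ (w.1.embedding.injective (by rw [map_zero]; exact Complex.ext h (UnitaryGroup.im_embedding_eq_zero_of_complexConj_eq L w (hherm _))))
  have hs := sign_intCast_mul_self hre
  have hη := archMajoritySign_mul_self L (Matrix.diagonal α) w
  linear_combination (archMajoritySign L (Matrix.diagonal α) w * archMajoritySign L (Matrix.diagonal α) w) * hs + hη

include hγH in
open scoped Classical in
/-- **(Δ-mirror), GENERAL FORM: `Δ″(γ_H(z), t(z∘ρ′)) = (K_{ρ′}·K_ρ) · Δ″(γ_H(z), t(z∘ρ))` FOR ALL `z`** — two partners of the same `H`-point differ by the constant sign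
`K_{ρ′}K_ρ ∈ {±1}` (★ p849548: `Δ″_ρ = K_ρ·(τ·D)` with `τ·D` partner-free; `K_ρ² = 1`). [cite: Rogawski1990, §4.9 p. 55; §14.6 p. 242] [cite: LanglandsShelstad1987, §2.4] -/
theorem archExplicitDelta_cayleyTorus_relabel_eq_sign_mul_relabel (hα : ∀ i, α i ≠ 0) (hherm : ∀ i, (IsCMField.complexConj L (α i) : L) = α i)
    (z : {w : InfinitePlace L // IsComplex w} → Fin 3 → Circle) (ρ ρ' : {w : InfinitePlace L // IsComplex w} → Perm (Fin 3)) :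
    archExplicitDelta L (Matrix.diagonal α) (γH z) μ (UnitaryGroup.archDiagTorus L 3 α fun w => z w ∘ ρ' w) =
      (((∏ w : {w : InfinitePlace L // IsComplex w}, ((SignType.sign ((w.1.embedding (α ((ρ' w).symm 1))).re) : ℤ) * archMajoritySign L (Matrix.diagonal α) w)) *
          (∏ w : {w : InfinitePlace L // IsComplex w}, ((SignType.sign ((w.1.embedding (α ((ρ w).symm 1))).re) : ℤ) * archMajoritySign L (Matrix.diagonal α) w)) : ℤ) : ℂ) *
        archExplicitDelta L (Matrix.diagonal α) (γH z) μ (UnitaryGroup.archDiagTorus L 3 α fun w => z w ∘ ρ w) := by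
  rw [archExplicitDelta_cayleyTorus_relabel_eq_mul L α γH hγH μ z ρ', archExplicitDelta_cayleyTorus_relabel_eq_mul L α γH hγH μ z ρ]
  have h1 := kappaSignProd_mul_self L α hα hherm ρ
  set Kρ : ℤ := ∏ w : {w : InfinitePlace L // IsComplex w}, ((SignType.sign ((w.1.embedding (α ((ρ w).symm 1))).re) : ℤ) * archMajoritySign L (Matrix.diagonal α) w)
  set Kρ' : ℤ := ∏ w : {w : InfinitePlace L // IsComplex w}, ((SignType.sign ((w.1.embedding (α ((ρ' w).symm 1))).re) : ℤ) * archMajoritySign L (Matrix.diagonal α) w)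
  calc (Kρ' : ℂ) * (archTau L (γH z) μ * (archWeylRatio L (γH z) : ℂ))
      = ((Kρ' * (Kρ * Kρ) : ℤ) : ℂ) * (archTau L (γH z) μ * (archWeylRatio L (γH z) : ℂ)) := by rw [h1, mul_one]
    _ = ((Kρ' * Kρ : ℤ) : ℂ) * ((Kρ : ℂ) * (archTau L (γH z) μ * (archWeylRatio L (γH z) : ℂ))) := by push_cast; ring

open scoped Classical in
/-- **ONLY THE `w`-FACTOR MOVES**: for `ρ° = update ρ w (π·ρ_w)`, `K_{ρ°}·K_ρ = sgn(re σ_w α_{ρ_w⁻¹(π⁻¹ 1)}) · sgn(re σ_w α_{ρ_w⁻¹(1)})` (the `v ≠ w` factors square to `1`,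
`η_w² = 1`). [cite: Rogawski1990, §14.6 p. 242] -/
theorem kappaSignProd_update_mul (hα : ∀ i, α i ≠ 0) (hherm : ∀ i, (IsCMField.complexConj L (α i) : L) = α i)
    (ρ : {w : InfinitePlace L // IsComplex w} → Perm (Fin 3)) (w : {w : InfinitePlace L // IsComplex w}) (π : Perm (Fin 3)) :
    (∏ v : {w : InfinitePlace L // IsComplex w}, ((SignType.sign ((v.1.embedding (α ((Function.update ρ w (π * ρ w) v).symm 1))).re) : ℤ) * archMajoritySign L (Matrix.diagonal α) v)) *
      (∏ v : {w : InfinitePlace L // IsComplex w}, ((SignType.sign ((v.1.embedding (α ((ρ v).symm 1))).re) : ℤ) * archMajoritySign L (Matrix.diagonal α) v)) =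
      (SignType.sign ((w.1.embedding (α ((ρ w).symm (π.symm 1)))).re) : ℤ) * (SignType.sign ((w.1.embedding (α ((ρ w).symm 1))).re) : ℤ) := by
  have hre : ∀ i, (w.1.embedding (α i)).re ≠ 0 := fun i h =>
    hα _ (w.1.embedding.injective (by rw [map_zero]; exact Complex.ext h (UnitaryGroup.im_embedding_eq_zero_of_complexConj_eq L w (hherm _))))
  rw [← Finset.mul_prod_erase Finset.univ _ (Finset.mem_univ w), ← Finset.mul_prod_erase Finset.univ _ (Finset.mem_univ w), Function.update_self,
    Finset.prod_congr rfl fun v hv => by rw [Function.update_of_ne (Finset.ne_of_mem_erase hv)]]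
  have hrest := kappaSignProd_mul_self L α hα hherm ρ
  rw [← Finset.mul_prod_erase Finset.univ _ (Finset.mem_univ w)] at hrest
  set R : ℤ := ∏ v ∈ Finset.univ.erase w, ((SignType.sign ((v.1.embedding (α ((ρ v).symm 1))).re) : ℤ) * archMajoritySign L (Matrix.diagonal α) v) with hR
  have hπ : (π * ρ w).symm 1 = (ρ w).symm (π.symm 1) := by simp [Equiv.Perm.mul_def]
  rw [hπ]
  have hs := sign_intCast_mul_self (hre ((ρ w).symm 1))
  linear_combination ((SignType.sign ((w.1.embedding (α ((ρ w).symm (π.symm 1)))).re) : ℤ) * (SignType.sign ((w.1.embedding (α ((ρ w).symm 1))).re) : ℤ)) * hrest -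
    ((SignType.sign ((w.1.embedding (α ((ρ w).symm (π.symm 1)))).re) : ℤ) * (SignType.sign ((w.1.embedding (α ((ρ w).symm 1))).re) : ℤ) *
      archMajoritySign L (Matrix.diagonal α) w ^ 2 * R ^ 2) * hs

/-- `sgn(a)·sgn(b) = −1` when `ab < 0`, `= 1` when `0 < ab`. [folklore] -/
private theorem sign_mul_sign_of_mul_neg {a b : ℝ} (h : a * b < 0) : (SignType.sign a : ℤ) * (SignType.sign b : ℤ) = -1 := by
  rcases mul_neg_iff.mp h with ⟨ha, hb⟩ | ⟨ha, hb⟩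
  · rw [sign_pos ha, sign_neg hb]; simp
  · rw [sign_neg ha, sign_pos hb]; simp

/-- `sgn(a)·sgn(b) = 1` when `0 < ab`. [folklore] -/
private theorem sign_mul_sign_of_mul_pos {a b : ℝ} (h : 0 < a * b) : (SignType.sign a : ℤ) * (SignType.sign b : ℤ) = 1 := by
  rcases mul_pos_iff.mp h with ⟨ha, hb⟩ | ⟨ha, hb⟩
  · rw [sign_pos ha, sign_pos hb]; simp
  · rw [sign_neg ha, sign_neg hb]; simp

include hγH in
open scoped Classical in
/-- **(Δ-mirror) ACROSS THE `G`-WALL `z₁ = z₀`, NONCOMPACT**: the mirror partner `ρ° = update ρ w ((0 1)·ρ_w)` (the slots of `z_{w,0}` and `z_{w,1}` exchanged) has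
`Δ″(γ_H(z), t(z∘ρ°)) = −Δ″(γ_H(z), t(z∘ρ))` for ALL `z` when those two slots have opposite form signs. [cite: Rogawski1990, §14.6 p. 242; §8.2 p. 123] [cite: Shelstad1979, §4] -/
theorem archExplicitDelta_cayleyTorus_mirror01_of_neg (hα : ∀ i, α i ≠ 0) (hherm : ∀ i, (IsCMField.complexConj L (α i) : L) = α i)
    (z : {w : InfinitePlace L // IsComplex w} → Fin 3 → Circle) (ρ : {w : InfinitePlace L // IsComplex w} → Perm (Fin 3)) (w : {w : InfinitePlace L // IsComplex w})
    (hnc : (w.1.embedding (α ((ρ w).symm 0))).re * (w.1.embedding (α ((ρ w).symm 1))).re < 0) :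
    archExplicitDelta L (Matrix.diagonal α) (γH z) μ (UnitaryGroup.archDiagTorus L 3 α fun v => z v ∘ Function.update ρ w (Equiv.swap (0 : Fin 3) 1 * ρ w) v) =
      -archExplicitDelta L (Matrix.diagonal α) (γH z) μ (UnitaryGroup.archDiagTorus L 3 α fun v => z v ∘ ρ v) := by
  rw [archExplicitDelta_cayleyTorus_relabel_eq_sign_mul_relabel L α γH hγH μ hα hherm z ρ _, kappaSignProd_update_mul L α hα hherm ρ w,
    show (Equiv.swap (0 : Fin 3) 1).symm 1 = 0 by simp [Equiv.swap_apply_right], sign_mul_sign_of_mul_neg hnc]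
  simp

include hγH in
open scoped Classical in
/-- (Δ-mirror) across the `G`-wall `z₁ = z₀`, COMPACT: `Δ″(γ_H(z), t(z∘ρ°)) = Δ″(γ_H(z), t(z∘ρ))` when the two slots have the same form sign. [cite: Rogawski1990, §14.6 p. 242] -/
theorem archExplicitDelta_cayleyTorus_mirror01_of_pos (hα : ∀ i, α i ≠ 0) (hherm : ∀ i, (IsCMField.complexConj L (α i) : L) = α i)
    (z : {w : InfinitePlace L // IsComplex w} → Fin 3 → Circle) (ρ : {w : InfinitePlace L // IsComplex w} → Perm (Fin 3)) (w : {w : InfinitePlace L // IsComplex w})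
    (hpos : 0 < (w.1.embedding (α ((ρ w).symm 0))).re * (w.1.embedding (α ((ρ w).symm 1))).re) :
    archExplicitDelta L (Matrix.diagonal α) (γH z) μ (UnitaryGroup.archDiagTorus L 3 α fun v => z v ∘ Function.update ρ w (Equiv.swap (0 : Fin 3) 1 * ρ w) v) =
      archExplicitDelta L (Matrix.diagonal α) (γH z) μ (UnitaryGroup.archDiagTorus L 3 α fun v => z v ∘ ρ v) := by
  rw [archExplicitDelta_cayleyTorus_relabel_eq_sign_mul_relabel L α γH hγH μ hα hherm z ρ _, kappaSignProd_update_mul L α hα hherm ρ w,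
    show (Equiv.swap (0 : Fin 3) 1).symm 1 = 0 by simp [Equiv.swap_apply_right], sign_mul_sign_of_mul_pos hpos]
  simp

include hγH in
open scoped Classical in
/-- **(Δ-mirror) ACROSS THE `G`-WALL `z₁ = z₂`, NONCOMPACT**: `ρ° = update ρ w ((1 2)·ρ_w)`, opposite signs on the slots of `z_{w,2}`, `z_{w,1}` ⇒ `Δ″_{ρ°} = −Δ″_ρ` for all `z`.
[cite: Rogawski1990, §14.6 p. 242; §8.2 p. 123] [cite: Shelstad1979, §4] -/
theorem archExplicitDelta_cayleyTorus_mirror12_of_neg (hα : ∀ i, α i ≠ 0) (hherm : ∀ i, (IsCMField.complexConj L (α i) : L) = α i)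
    (z : {w : InfinitePlace L // IsComplex w} → Fin 3 → Circle) (ρ : {w : InfinitePlace L // IsComplex w} → Perm (Fin 3)) (w : {w : InfinitePlace L // IsComplex w})
    (hnc : (w.1.embedding (α ((ρ w).symm 2))).re * (w.1.embedding (α ((ρ w).symm 1))).re < 0) :
    archExplicitDelta L (Matrix.diagonal α) (γH z) μ (UnitaryGroup.archDiagTorus L 3 α fun v => z v ∘ Function.update ρ w (Equiv.swap (1 : Fin 3) 2 * ρ w) v) =
      -archExplicitDelta L (Matrix.diagonal α) (γH z) μ (UnitaryGroup.archDiagTorus L 3 α fun v => z v ∘ ρ v) := by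
  rw [archExplicitDelta_cayleyTorus_relabel_eq_sign_mul_relabel L α γH hγH μ hα hherm z ρ _, kappaSignProd_update_mul L α hα hherm ρ w,
    show (Equiv.swap (1 : Fin 3) 2).symm 1 = 2 by simp [Equiv.swap_apply_left], sign_mul_sign_of_mul_neg hnc]
  simp

include hγH in
open scoped Classical in
/-- (Δ-mirror) across the `G`-wall `z₁ = z₂`, COMPACT: `Δ″_{ρ°} = Δ″_ρ`. [cite: Rogawski1990, §14.6 p. 242] -/
theorem archExplicitDelta_cayleyTorus_mirror12_of_pos (hα : ∀ i, α i ≠ 0) (hherm : ∀ i, (IsCMField.complexConj L (α i) : L) = α i)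
    (z : {w : InfinitePlace L // IsComplex w} → Fin 3 → Circle) (ρ : {w : InfinitePlace L // IsComplex w} → Perm (Fin 3)) (w : {w : InfinitePlace L // IsComplex w})
    (hpos : 0 < (w.1.embedding (α ((ρ w).symm 2))).re * (w.1.embedding (α ((ρ w).symm 1))).re) :
    archExplicitDelta L (Matrix.diagonal α) (γH z) μ (UnitaryGroup.archDiagTorus L 3 α fun v => z v ∘ Function.update ρ w (Equiv.swap (1 : Fin 3) 2 * ρ w) v) =
      archExplicitDelta L (Matrix.diagonal α) (γH z) μ (UnitaryGroup.archDiagTorus L 3 α fun v => z v ∘ ρ v) := by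
  rw [archExplicitDelta_cayleyTorus_relabel_eq_sign_mul_relabel L α γH hγH μ hα hherm z ρ _, kappaSignProd_update_mul L α hα hherm ρ w,
    show (Equiv.swap (1 : Fin 3) 2).symm 1 = 2 by simp [Equiv.swap_apply_left], sign_mul_sign_of_mul_pos hpos]
  simp

include hγH in
open scoped Classical in
/-- **(Δ-mirror) ACROSS THE `H`-WALL `z₀ = z₂`: ALWAYS `+`** — `ρ° = update ρ w ((0 2)·ρ_w)` keeps the slot of the 1-block eigenvalue `z_{w,1}`, so `K_{ρ°} = K_ρ` and
`Δ″_{ρ°} = Δ″_ρ` for all `z` («equal κ across the H-wall»: the jumps ADD, D2′-SPEC §3). [cite: Rogawski1990, §14.6 p. 242; §8.2 p. 124] [cite: Shelstad1979, §4] -/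
theorem archExplicitDelta_cayleyTorus_mirror02 (hα : ∀ i, α i ≠ 0) (hherm : ∀ i, (IsCMField.complexConj L (α i) : L) = α i)
    (z : {w : InfinitePlace L // IsComplex w} → Fin 3 → Circle) (ρ : {w : InfinitePlace L // IsComplex w} → Perm (Fin 3)) (w : {w : InfinitePlace L // IsComplex w}) :
    archExplicitDelta L (Matrix.diagonal α) (γH z) μ (UnitaryGroup.archDiagTorus L 3 α fun v => z v ∘ Function.update ρ w (Equiv.swap (0 : Fin 3) 2 * ρ w) v) =
      archExplicitDelta L (Matrix.diagonal α) (γH z) μ (UnitaryGroup.archDiagTorus L 3 α fun v => z v ∘ ρ v) := by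
  have hre : (w.1.embedding (α ((ρ w).symm 1))).re ≠ 0 := fun h =>
    hα _ (w.1.embedding.injective (by rw [map_zero]; exact Complex.ext h (UnitaryGroup.im_embedding_eq_zero_of_complexConj_eq L w (hherm _))))
  rw [archExplicitDelta_cayleyTorus_relabel_eq_sign_mul_relabel L α γH hγH μ hα hherm z ρ _, kappaSignProd_update_mul L α hα hherm ρ w,
    show (Equiv.swap (0 : Fin 3) 2).symm 1 = 1 by simp [Equiv.swap_apply_of_ne_of_ne], sign_intCast_mul_self hre]
  simp

end Mirror

end Literature.NumberTheory.Rogawski1990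

end
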